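import Summits.BirchSwinnertonDyer.BirchSwinnertonDyer.Theorems.ByReductionTypeAtTwoRankOneSigmaHeightRegulatorValuation
import Summits.BirchSwinnertonDyer.BirchSwinnertonDyer.Theorems.ByReductionTypeAtTwoRankOneSigmaHeightLogFreeLaw
import Summits.BirchSwinnertonDyer.BirchSwinnertonDyer.Theorems.ByReductionTypeAtTwoRankOneSigmaSqRigidity
import Summits.BirchSwinnertonDyer.BirchSwinnertonDyer.Theorems.ByReductionTypeAtTwoRankOneSigmaSqHeightData
import HarnessLib

/-!
# Route `ByReductionTypeAtTwo`, crux `RankOneAtTwoBigImageOddLocal` (item stmt-BirchSwinnertonDyer-23715), line AN62, σ₀-LEMMA BLOCK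
# (cell `bsd-f1-sign2`, planner seat `-an` g50; `--supports 23715`, helper):
# **THE η-HEIGHT AT 2 EXISTS AND OBEYS THE LEVEL-ONE LAWS — ONE BINDER-FREE PACKAGE**

HONEST FRAMING (D-0036/D-0054): THEOREMS ONLY (no definition, no named fact, no `sorry`, no instance).  The files
`…SigmaHeight{LevelOneLawUnconditional, ResidueCertificate, ValuationLaw, LogFreeLaw, RegulatorValuation}` state their laws for an
arbitrary σ-form height datum `(Sq, D)` given as hypotheses.  Here the hypotheses are DISCHARGED from the tree: for every elliptic
`ℤ`-integral `V/ℚ` with `a₁ = 0` the even solution `Sq` of the σ-ODE with `c = 0` exists (`existsUnique_isFormallyEven_satisfiesSigmaSqODE_zero`;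
`[t³]Sq = a₁ = 0` by `two_mul_coeff_three_of_isFormallyEven`) and carries a height datum `D` (`exists_heightData_sigmaSqZero_two`).
Hence (`exists_heightData_levelOne_laws_two`): **there is a `2`-adic height datum `D` on `V(ℚ)` (the η-height) such that for every
level-one point `Q = (x, y)` (`‖x‖₂ = 4`) with non-singular reduction everywhere, with `a = num x`, `n = a − 1 − 8a₄`:
`‖⟨Q,Q⟩_D − ((a−1) − (a−1)²/2 − 8a₄)‖₂ ≤ 1/32`; `32 ∤ n ⟹ ‖⟨Q,Q⟩_D‖₂ = ‖n‖₂`; and for every `P`, `m ≥ 1` with `mP = Q`: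
`‖⟨P,P⟩_D‖₂ ≤ ¼/‖m‖₂²`, `= ‖n‖₂/‖m‖₂²` if `32 ∤ n`, and then `P` has infinite order.**  All such data agree at these points
(`…TateLimit.pairing_eq_of_sigma_formula`).  Nothing here is a statement about `BSDp`; item 23715 stays OPEN; BSD is proved for no curve.
References: [cite: MazurSteinTate2006, §1, Rem. 1.4] [cite: Silverman2005DivPoly, §5 Rem. 2] [cite: Gouvea1993PadicNumbers, §5.7].
-/

set_option autoImplicit false

noncomputable section

open scoped Classical

open WeierstrassCurve PowerSeries Literature Literature.NumberTheory.EllipticCurves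

namespace Summit.BirchSwinnertonDyer.BirchSwinnertonDyer.Theorems

namespace NaiveSigmaLogAtTwo

/-- **The η-datum exists** (`a₁ = 0`, elliptic, `ℤ`-integral): an even σ-ODE solution `Sq = t² + O(t⁴)` with `c = 0` together with a
height datum `D` at `2` whose pairing on the local-conditions locus is `log₂ den x − log₂ Σ(−x/y)`, `Σ² := Sq`.
[cite: MazurSteinTate2006, §1, Rem. 1.4] [cite: Silverman2005DivPoly, §5 Rem. 2] -/
theorem exists_etaHeightData_two (V : WeierstrassCurve ℚ) [V.IsElliptic] [V.IsIntegral ℤ] (ha1 : V.a₁ = 0) :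
    ∃ (Sq : ℚ_[2]⟦X⟧) (D : PAdicHeightData V 2), constantCoeff Sq = 0 ∧ coeff 1 Sq = 0 ∧ coeff 2 Sq = 1 ∧ coeff 3 Sq = 0 ∧
      (V.baseChange ℚ_[2]).SatisfiesSigmaSqODE Sq 0 ∧
      ∀ {x y : ℚ} (h : V.toAffine.Nonsingular x y), V.SatisfiesLocalConditions 2 (.some x y h) →
        D.pairing (.some x y h) (.some x y h) = padicLog 2 ((x.den : ℚ) : ℚ_[2]) - padicLog 2 (padicEval Sq (-(x : ℚ_[2]) / y)) := by
  obtain ⟨Sq, ⟨h0, h1, h2, heven, hODE⟩, -⟩ := existsUnique_isFormallyEven_satisfiesSigmaSqODE_zero (V.baseChange ℚ_[2])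
  have h3 : coeff 3 Sq = 0 := by
    have e := two_mul_coeff_three_of_isFormallyEven heven h0 h1 h2
    have ha : (V.baseChange ℚ_[2]).a₁ = 0 := by simp [WeierstrassCurve.baseChange, ha1]
    rw [ha, mul_zero] at e
    have : (2 : ℚ_[2]) ≠ 0 := two_ne_zero
    exact (mul_eq_zero.mp e).resolve_left this
  obtain ⟨D, hD⟩ := exists_heightData_sigmaSqZero_two V ha1 Sq h0 h1 h2 h3 hODE
  exact ⟨Sq, D, h0, h1, h2, h3, hODE, fun h hloc => hD h hloc⟩

/-- **THE η-HEIGHT AT 2 EXISTS AND OBEYS THE LEVEL-ONE LAWS** (elliptic, `ℤ`-integral, `a₁ = 0`): there is a `2`-adic height datum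
`D` such that for every level-one point `Q = (x, y)` (`‖x‖₂ = 4`) with non-singular reduction at every prime, with `a = num x`:
(1) `‖⟨Q,Q⟩_D − ((a−1) − (a−1)²/2 − 8a₄)‖₂ ≤ 1/32`; (2) if `32 ∤ a − 1 − 8a₄` then `‖⟨Q,Q⟩_D‖₂ = ‖a − 1 − 8a₄‖₂`;
(3) for every point `P` and `m ≠ 0` with `mP = Q`: `‖⟨P,P⟩_D‖₂ ≤ ¼ / ‖m‖₂²`, and if `32 ∤ a − 1 − 8a₄` then
`‖⟨P,P⟩_D‖₂ = ‖a − 1 − 8a₄‖₂ / ‖m‖₂²` and `P` has infinite order.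
[cite: MazurSteinTate2006, §1] [cite: Gouvea1993PadicNumbers, §5.7 Prop. 5.7.8] [cite: SilvermanAEC2009, VII.2.2] -/
theorem exists_heightData_levelOne_laws_two (V : WeierstrassCurve ℚ) [V.IsElliptic] [V.IsIntegral ℤ] (ha1 : V.a₁ = 0) :
    ∃ D : PAdicHeightData V 2, ∀ {x y : ℚ} (h : V.toAffine.Nonsingular x y), ‖(x : ℚ_[2])‖ = 4 →
      (∀ ℓ : ℕ, ℓ.Prime → V.HasNonsingularReductionAt ℓ x y) →
      ‖D.pairing (.some x y h) (.some x y h)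
          - (((x.num : ℚ_[2]) - 1) - ((x.num : ℚ_[2]) - 1) ^ 2 / 2 - 8 * (V.a₄ : ℚ_[2]))‖ ≤ 32⁻¹ ∧
      (∀ A₄ : ℤ, V.a₄ = A₄ → ¬ (32 : ℤ) ∣ x.num - 1 - 8 * A₄ →
        ‖D.pairing (.some x y h) (.some x y h)‖ = ‖((x.num - 1 - 8 * A₄ : ℤ) : ℚ_[2])‖) ∧
      (∀ (P : V.toAffine.Point) (m : ℕ), m ≠ 0 → m • P = .some x y h →
        ‖D.pairing P P‖ ≤ 4⁻¹ / ‖(m : ℚ_[2])‖ ^ 2 ∧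
        ∀ A₄ : ℤ, V.a₄ = A₄ → ¬ (32 : ℤ) ∣ x.num - 1 - 8 * A₄ →
          ‖D.pairing P P‖ = ‖((x.num - 1 - 8 * A₄ : ℤ) : ℚ_[2])‖ / ‖(m : ℚ_[2])‖ ^ 2 ∧ ¬ IsOfFinAddOrder P) := by
  obtain ⟨Sq, D, h0, h1, h2, h3, hODE, hD⟩ := exists_etaHeightData_two V ha1
  refine ⟨D, fun h hx hns => ⟨?_, ?_, ?_⟩⟩
  · exact norm_pairing_sub_quadratic_le V ha1 Sq h0 h1 h2 h3 hODE D hD h hx hns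
  · intro A₄ hA4 h32
    exact norm_pairing_eq_norm_of_not_dvd V ha1 Sq h0 h1 h2 h3 hODE D hD h hx hns hA4 h32
  · intro P m hm0 hm
    refine ⟨norm_pairing_self_le_of_nsmul_eq V ha1 Sq h0 h1 h2 h3 hODE D hD P hm0 h hm hx hns, ?_⟩
    intro A₄ hA4 h32
    exact ⟨norm_pairing_self_eq_of_nsmul_eq_of_not_dvd V ha1 Sq h0 h1 h2 h3 hODE D hD P hm0 h hm hx hns hA4 h32,
      (pairing_self_ne_zero_of_nsmul_eq_of_not_dvd V ha1 Sq h0 h1 h2 h3 hODE D hD P m h hm hx hns hA4 h32).2⟩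

end NaiveSigmaLogAtTwo

end Summit.BirchSwinnertonDyer.BirchSwinnertonDyer.Theorems
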